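import Summits.HodgeConjecture.CorCM.Census.OddDegreeParityLawRelative
import Summits.HodgeConjecture.CorCM.Census.OddSliceTranslation

/-!
# The faithful full slice of the Galois CM type `(ℤ/2 × A, (1,0))`, `A` any finite abelian group, representative-free: labels = maps
# `A → ℤ/2`, Pohlmann forms, the Hodge lattice, pairs, Galois translation, weights

COR-CM (cell `pub-hodgecm2`), count-neutral kernel census by the binder seat b09 (gen 26; lane ODD-SLICE-FACES = gen 25's lane
CYCLIC-PRIME-FACES (`Census/CyclicPrimeTypeModel` → … → `Census/CyclicPrimeFacesSlice`, the case `A = ℤ/p`) for EVERY abelian group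
`A` of odd order: the `#OrbitsA A` generating Galois orbits of the faithful full odd slice — b17's lower bound `oddSlice_law` of
`Census/OddDegreeParityLawCyclicPrime.lean` §5, an equality by the seat's `Census/OddSliceUpperBound.lean` — can be taken to be
RANK-FOUR FACE classes).  Part I of the lane (`OddSliceFacesModel` → `OddSliceFacesSquares` → `OddSliceFacesDescent` →
`OddSliceFacesGenerate` → `OddSliceFacesCount` → `OddSliceFacesRecord`).  Bookkeeping definitions + theorems, Mathlib-only mathematics on top of b17's
`Census/OddDegreeParityLaw*.lean`; no `decide` table, no certificate, no named fact, no geometry, no `sorry`.  The statements and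
proofs are those of `Census/CyclicPrimeTypeModel.lean` with `ℤ/p` replaced by `A` (nothing in this part uses more than finiteness).
HC_CM is not proved anywhere in this cell; nothing here is a headline and nothing here produces a period.

THE MODEL (dictionary as in `Census/OddDegreeParityLaw.lean`, not formalised).  `F` Galois CM with `G = Gal(F/ℚ) = ℤ/2 × A`, `c = (1,0)`
(every `G` of order `≡ 2 (mod 4)` has this shape with `|A|` odd; b17 takes `A` abelian, and so does this lane).  CM types are the
graphs of maps `ψ : A → ℤ/2` (`Ty A`); the faithful full slice of `(G, c)` is `E` (the two constant maps) and one simple CM abelian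
variety per `G`-orbit of nonconstant maps, with label group `A / Per(ψ)` (b17: stabilisers are `{0} × Per(ψ)` when `|A|` is odd,
`stabiliser_fst_eq_zero`), so that the `2^{|A|}` maps ARE the eigen-labels of the slice, one label per map (part V,
`OddSliceFacesRecord`, proves the bijection with b17's sigma-type labels `Pt (AbQ A)`).  In this labelling: the Pohlmann coefficient of
`g = (a, t) ∈ G` at the label `ψ` is `+1` if `ψ t = a` («`g ∈ ψ`») and `−1` otherwise (`coef`), the Hodge lattice `H` is the common
kernel of the `2|A|` forms (`hodge`), the conjugate of `ψ` is `ψ + 1`, the divisor classes are `e_ψ + e_{ψ+1}` (`pairVec`, `pairs`), and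
`G` acts on labels by `(tw (a,t) ψ)(s) = ψ(s + t) + a`, on exponent vectors by `transl`.

CONTENT (the `ℤ/2` trivia `zmod2_add_one_eq_iff` is reused from `Census/OddSliceTranslation.lean`).  §1 the action `tw` (`tw_tw`,
`twEquiv`), coefficients (`coef_tw`, `coef_add_one`), `transl`/`translHom`, indicator types `ind Q = 𝟙_Q` and unit types `δ i`
(`ind_add_delta : 𝟙_Q + δ i = 𝟙_{Q∖i}` for `i ∈ Q`, `tw_add_delta`); §2 forms, `H`, pairs `≤ H` (`pairVec_mem`), `H` is `G`-stable
(`transl_mem`), translation of unit vectors (`transl_single`), membership tested on the forms of `(0, t)` (`mem_hodge_iff`),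
`e_{χ+1} = pairVec χ − e_χ`; §3 the weight `wt ψ = #{ψ = 1}` (`wt_add_one : wt (ψ+1) = |A| − wt ψ`, `wt_tw_zero`, `wt_tw_one`, `wt_ind`,
`ind_filter`), types of weight `≥ 2` have two defects, types of weight `≤ 1` are `0` or `δ s`.  All [folklore].

## References
* [Pohlmann1968] H. Pohlmann, Algebraic cycles on abelian varieties of complex multiplication type, Ann. of Math. 88 (1968), Thm 1.
* [Milne1999] J. S. Milne, Lefschetz motives and the Tate conjecture, Compositio Math. 117 (1999), Prop. 2.1, p. 54.
* [Weil1977HodgeRing] A. Weil, Abelian varieties and the Hodge ring, Œuvres Scientifiques III, [1977c], 421–429.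
-/

namespace Summit.HodgeConjecture.CorCM.Census.OddSliceFacesModel

open Finset

/-! ## §1 Labels, the action, coefficients, indicator and unit types (no finiteness needed) -/

section Labels

variable (A : Type) [AddCommGroup A] [DecidableEq A]

/-- The labels of the faithful full slice of `(ℤ/2 × A, (1,0))`: CM types as maps `A → ℤ/2`. [folklore] -/
abbrev Ty : Type := A → ZMod 2

/-- Pohlmann's coefficient of `g = (a, t) ∈ G` at the label `ψ`: `+1` if `ψ t = a` (`g` lies in the type), `−1` otherwise.
[cite: Pohlmann1968, Thm 1] -/
def coef (g : ZMod 2 × A) (ψ : Ty A) : ℤ := if ψ g.2 = g.1 then 1 else -1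

/-- The action of `G = ℤ/2 × A` on labels: `(tw (a,t) ψ)(s) = ψ(s + t) + a`. [folklore] -/
def tw (g : ZMod 2 × A) (ψ : Ty A) : Ty A := fun s => ψ (s + g.2) + g.1

/-- Galois translate of an exponent vector: `(g·v)(ψ) = v(g⁻¹·ψ)`. [folklore] -/
def transl (g : ZMod 2 × A) (v : Ty A → ℤ) : Ty A → ℤ := fun ψ => v (tw A (-g) ψ)

omit [AddCommGroup A] [DecidableEq A] in
/-- `ψ + 1 + 1 = ψ`. [folklore] -/
theorem add_one_add_one (ψ : Ty A) : ψ + 1 + 1 = ψ := by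
  funext s
  have key : ∀ u : ZMod 2, u + 1 + 1 = u := by decide
  exact key (ψ s)

omit [AddCommGroup A] [DecidableEq A] in
/-- The coefficients at conjugate labels are opposite. [folklore] -/
theorem coef_add_one (g : ZMod 2 × A) (ψ : Ty A) : coef A g (ψ + 1) = -coef A g ψ := by
  have key : ∀ u w : ZMod 2, (if u + 1 = w then (1 : ℤ) else -1) = -(if u = w then (1 : ℤ) else -1) := by decide
  exact key _ _

omit [DecidableEq A] in
/-- Composition of twists. [folklore] -/
theorem tw_tw (g h : ZMod 2 × A) (ψ : Ty A) : tw A g (tw A h ψ) = tw A (h + g) ψ := by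
  funext s
  simp only [tw, Prod.snd_add, Prod.fst_add]
  rw [add_assoc s, add_comm g.2 h.2, add_assoc]

omit [DecidableEq A] in
/-- Twisting by `g` then `−g`. [folklore] -/
theorem tw_neg_tw (g : ZMod 2 × A) (ψ : Ty A) : tw A (-g) (tw A g ψ) = ψ := by
  rw [tw_tw, add_neg_cancel]
  funext s; simp [tw]

omit [DecidableEq A] in
/-- Twisting by `−g` then `g`. [folklore] -/
theorem tw_tw_neg (g : ZMod 2 × A) (ψ : Ty A) : tw A g (tw A (-g) ψ) = ψ := by
  simpa using tw_neg_tw A (-g) ψ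

/-- Twisting by `g` as a permutation of the labels. [folklore] -/
def twEquiv (g : ZMod 2 × A) : Ty A ≃ Ty A where
  toFun := tw A g
  invFun := tw A (-g)
  left_inv := tw_neg_tw A g
  right_inv := tw_tw_neg A g

omit [DecidableEq A] in
/-- Twisting by `(0, 0)` is the identity. [folklore] -/
theorem tw_zero (ψ : Ty A) : tw A 0 ψ = ψ := by
  funext s; simp [tw]

omit [DecidableEq A] in
/-- Twisting by `c = (1,0)` is conjugation. [folklore] -/
theorem tw_one_zero (ψ : Ty A) : tw A (1, 0) ψ = ψ + 1 := by
  funext s; simp [tw]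

omit [DecidableEq A] in
/-- Twisting commutes with conjugation. [folklore] -/
theorem tw_add_one (g : ZMod 2 × A) (ψ : Ty A) : tw A g (ψ + 1) = tw A g ψ + 1 := by
  funext s
  simp only [tw, Pi.add_apply, Pi.one_apply]
  ring

omit [DecidableEq A] in
/-- A twist by `(1, t)` is the conjugate of the twist by `(0, t)`. [folklore] -/
theorem tw_one (t : A) (ψ : Ty A) : tw A (1, t) ψ = tw A (0, t) ψ + 1 := by
  funext s; simp [tw]

omit [DecidableEq A] in
/-- The coefficient of `h` at a twisted label is the coefficient of `g + h`. [folklore] -/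
theorem coef_tw (g h : ZMod 2 × A) (ψ : Ty A) : coef A h (tw A g ψ) = coef A (g + h) ψ := by
  have key : ∀ u a b : ZMod 2, (u + a = b) ↔ (u = a + b) := by decide
  have e1 : (tw A g ψ) h.2 = h.1 ↔ ψ ((g + h).2) = (g + h).1 := by
    simp only [tw, Prod.snd_add, Prod.fst_add, add_comm h.2 g.2]
    exact key _ _ _
  unfold coef
  by_cases hc : ψ ((g + h).2) = (g + h).1
  · rw [if_pos hc, if_pos (e1.mpr hc)]
  · rw [if_neg hc, if_neg (fun h' => hc (e1.mp h'))]
/-- The indicator type `𝟙_Q` of a set of places `Q ⊆ A` (the places of `F` over `k = F^A` are the elements of `A`). [folklore] -/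
def ind (Q : Finset A) : Ty A := fun s => if s ∈ Q then 1 else 0

/-- The unit type `δ i` (a single defect at the place `i`). [folklore] -/
def δ (i : A) : Ty A := Pi.single i 1

omit [AddCommGroup A] in
/-- Values of `δ`. [folklore] -/
theorem delta_apply (i s : A) : δ A i s = if s = i then 1 else 0 := by
  unfold δ
  rw [Pi.single_apply]

omit [AddCommGroup A] in
/-- Erasing a member `i ∈ Q`: `𝟙_Q + δ i = 𝟙_{Q ∖ i}`. [folklore] -/
theorem ind_add_delta {Q : Finset A} {i : A} (hi : i ∈ Q) : ind A Q + δ A i = ind A (Q.erase i) := by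
  funext s
  simp only [Pi.add_apply, ind, delta_apply, Finset.mem_erase]
  have h11 : (1 : ZMod 2) + 1 = 0 := by decide
  by_cases hs : s = i
  · subst hs
    rw [if_pos hi, if_pos rfl, h11, if_neg (fun h => h.1 rfl)]
  · rw [if_neg hs]
    by_cases hq : s ∈ Q
    · rw [if_pos hq, if_pos ⟨hs, hq⟩, add_zero]
    · rw [if_neg hq, if_neg (fun h => hq h.2), add_zero]

omit [AddCommGroup A] in
/-- Adjoining a non-member `i ∉ Q`: `𝟙_Q + δ i = 𝟙_{Q ∪ {i}}`. [folklore] -/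
theorem ind_add_delta_of_not_mem {Q : Finset A} {i : A} (hi : i ∉ Q) :
    ind A Q + δ A i = ind A (insert i Q) := by
  funext s
  simp only [Pi.add_apply, ind, delta_apply, Finset.mem_insert]
  by_cases hs : s = i
  · subst hs
    rw [if_neg hi, if_pos rfl, if_pos (Or.inl rfl), zero_add]
  · rw [if_neg hs]
    by_cases hq : s ∈ Q
    · rw [if_pos hq, if_pos (Or.inr hq), add_zero]
    · rw [if_neg hq, if_neg (fun h => h.elim hs hq), add_zero]

/-- Twist of a unit type at a shifted place. [folklore] -/
theorem delta_apply_add (g : ZMod 2 × A) (i s : A) : (δ A i) (s + g.2) = (δ A (i - g.2)) s := by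
  rw [delta_apply, delta_apply]
  by_cases h : s = i - g.2
  · rw [if_pos h, if_pos (by rw [h, sub_add_cancel])]
  · rw [if_neg h, if_neg (fun hh => h (by rw [← hh, add_sub_cancel_right]))]

/-- Twist of a flipped type: `tw g (φ + δ i) = tw g φ + δ (i − g.2)`. [folklore] -/
theorem tw_add_delta (g : ZMod 2 × A) (φ : Ty A) (i : A) :
    tw A g (φ + δ A i) = tw A g φ + δ A (i - g.2) := by
  funext s
  simp only [tw, Pi.add_apply]
  rw [delta_apply_add A g i s]
  ring

omit [DecidableEq A] in
/-- `transl` as composition with the inverse permutation. [folklore] -/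
theorem transl_eq_comp (g : ZMod 2 × A) (v : Ty A → ℤ) : transl A g v = v ∘ (twEquiv A g).symm := rfl

/-- Translation by `g` as a `ℤ`-linear map. [folklore] -/
def translHom (g : ZMod 2 × A) : (Ty A → ℤ) →ₗ[ℤ] (Ty A → ℤ) where
  toFun := transl A g
  map_add' _ _ := rfl
  map_smul' _ _ := rfl

omit [DecidableEq A] in
/-- `translHom` is `transl`. [folklore] -/
@[simp] theorem translHom_apply (g : ZMod 2 × A) (v : Ty A → ℤ) : translHom A g v = transl A g v := rfl

omit [DecidableEq A] in
/-- Translation by `0` is the identity. [folklore] -/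
theorem transl_zero (v : Ty A → ℤ) : transl A 0 v = v := by
  funext ψ
  simp only [transl, neg_zero, tw_zero]

end Labels

/-! ## §2 Forms, the Hodge lattice, pairs, translation -/

section Lattice

variable (A : Type) [AddCommGroup A] [Fintype A] [DecidableEq A]

/-- **The Hodge lattice** of the slice in the representative-free labelling: exponent vectors killed by all Pohlmann forms.
[cite: Pohlmann1968, Thm 1] -/
def hodge : Submodule ℤ (Ty A → ℤ) where
  carrier := {m | ∀ g : ZMod 2 × A, coef A g ⬝ᵥ m = 0}
  zero_mem' := by intro g; simp
  add_mem' := by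
    intro m m' hm hm' g
    rw [dotProduct_add, hm g, hm' g, add_zero]
  smul_mem' := by
    intro c m hm g
    rw [dotProduct_smul, hm g, smul_zero]

/-- The conjugate (divisor) pair through the label `ψ`: `e_ψ + e_{ψ+1}`. [folklore] -/
def pairVec (ψ : Ty A) : Ty A → ℤ := Pi.single ψ 1 + Pi.single (ψ + 1) 1

/-- The divisor sublattice `P = ℤ⟨pairs⟩`. [folklore] -/
def pairs : Submodule ℤ (Ty A → ℤ) := Submodule.span ℤ (Set.range (pairVec A))

omit [AddCommGroup A] in
/-- **The pairs are Hodge vectors.** [folklore] -/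
theorem pairVec_mem (ψ : Ty A) : pairVec A ψ ∈ hodge A := by
  intro g
  show coef A g ⬝ᵥ (Pi.single ψ 1 + Pi.single (ψ + 1) 1) = 0
  rw [dotProduct_add, dotProduct_single, dotProduct_single, coef_add_one]
  ring

omit [AddCommGroup A] in
/-- `P ≤ H`. [folklore] -/
theorem pairs_le_hodge : pairs A ≤ hodge A := by
  refine Submodule.span_le.mpr ?_
  rintro _ ⟨ψ, rfl⟩
  exact pairVec_mem A ψ

/-- The form of `h` on a translate is the form of `g + h`. [folklore] -/
theorem coef_dotProduct_transl (g h : ZMod 2 × A) (v : Ty A → ℤ) :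
    coef A h ⬝ᵥ transl A g v = coef A (g + h) ⬝ᵥ v := by
  rw [transl_eq_comp, dotProduct_comp_equiv_symm]
  congr 1
  funext ψ
  exact coef_tw A g h ψ

/-- **`H` is stable under Galois translation.** [folklore] -/
theorem transl_mem {v : Ty A → ℤ} (hv : v ∈ hodge A) (g : ZMod 2 × A) : transl A g v ∈ hodge A := by
  intro h
  rw [coef_dotProduct_transl]
  exact hv (g + h)

omit [DecidableEq A] in
/-- Translate of a unit vector. [folklore] -/
theorem transl_single (g : ZMod 2 × A) (ψ : Ty A) (c : ℤ) :
    transl A g (Pi.single ψ c) = Pi.single (tw A g ψ) c := by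
  funext χ
  have hiff : tw A (-g) χ = ψ ↔ χ = tw A g ψ := by
    constructor
    · intro h; rw [← h, tw_tw_neg]
    · intro h; rw [h, tw_neg_tw]
  simp only [transl, Pi.single_apply, hiff]

omit [AddCommGroup A] in
/-- Membership in `H` can be tested on the forms of `(0, t)`. [folklore] -/
theorem mem_hodge_iff (m : Ty A → ℤ) : m ∈ hodge A ↔ ∀ t : A, coef A (0, t) ⬝ᵥ m = 0 := by
  constructor
  · intro h t; exact h (0, t)
  · intro h g
    obtain ⟨a, t⟩ := g
    have h01 : ∀ u : ZMod 2, u = 0 ∨ u = 1 := by decide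
    rcases h01 a with rfl | rfl
    · exact h t
    · have hf : coef A (1, t) = -coef A (0, t) := by
        funext ψ
        have key : ∀ u : ZMod 2, (if u = 1 then (1 : ℤ) else -1) = -(if u = 0 then (1 : ℤ) else -1) := by decide
        simp only [coef, Pi.neg_apply]
        exact key (ψ t)
      show coef A (1, t) ⬝ᵥ m = 0
      rw [hf, neg_dotProduct, h t, neg_zero]

omit [AddCommGroup A] in
/-- The form of `(0, t)` on a unit vector. [folklore] -/
theorem coef_zero_dotProduct_single (t : A) (ψ : Ty A) (c : ℤ) :
    coef A (0, t) ⬝ᵥ Pi.single ψ c = (if ψ t = 0 then 1 else -1) * c := by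
  rw [dotProduct_single]
  simp only [coef]

omit [AddCommGroup A] [DecidableEq A] in
/-- A unit vector at a conjugate label is a pair minus the unit vector: `e_{χ+1} = pairVec χ − e_χ`. [folklore] -/
theorem single_add_one (χ : Ty A) : (Pi.single (χ + 1) (1 : ℤ) : Ty A → ℤ) = pairVec A χ - Pi.single χ 1 := by
  unfold pairVec; abel

/-! ## §3 Weights -/

/-- The weight `wt ψ = #{s : ψ s = 1}` (number of «defects» of the type). [folklore] -/
def wt (ψ : Ty A) : ℕ := (univ.filter fun s => ψ s = 1).card

omit [AddCommGroup A] [DecidableEq A] in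
/-- The weight is at most `|A|`. [folklore] -/
theorem wt_le (ψ : Ty A) : wt A ψ ≤ Fintype.card A := by
  unfold wt
  calc (univ.filter fun s => ψ s = 1).card ≤ (univ : Finset A).card := Finset.card_filter_le _ _
    _ = Fintype.card A := Finset.card_univ

omit [AddCommGroup A] [DecidableEq A] in
/-- Weight of the conjugate: `wt (ψ + 1) = |A| − wt ψ`. [folklore] -/
theorem wt_add_one (ψ : Ty A) : wt A (ψ + 1) = Fintype.card A - wt A ψ := by
  unfold wt
  have hfilt : (univ.filter fun s => (ψ + 1) s = 1) = univ.filter fun s => ¬ ψ s = 1 := by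
    ext s
    simp only [Finset.mem_filter, Finset.mem_univ, true_and, Pi.add_apply, Pi.one_apply]
    exact OddSliceUpperBound.zmod2_add_one_eq_iff (ψ s) 1
  rw [hfilt]
  have hc := Finset.card_filter_add_card_filter_not (s := (univ : Finset A)) (fun s => ψ s = 1)
  rw [Finset.card_univ] at hc
  omega

omit [DecidableEq A] in
/-- Weight is invariant under translation by `(0, t)`. [folklore] -/
theorem wt_tw_zero (t : A) (ψ : Ty A) : wt A (tw A (0, t) ψ) = wt A ψ := by
  unfold wt
  refine Finset.card_equiv (Equiv.addRight t) ?_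
  intro s
  simp [tw]

omit [DecidableEq A] in
/-- Weight of a twist by `(1, t)`: `|A| − wt ψ`. [folklore] -/
theorem wt_tw_one (t : A) (ψ : Ty A) : wt A (tw A (1, t) ψ) = Fintype.card A - wt A ψ := by
  rw [tw_one, wt_add_one, wt_tw_zero]

omit [AddCommGroup A] in
/-- `wt 𝟙_Q = |Q|`. [folklore] -/
theorem wt_ind (Q : Finset A) : wt A (ind A Q) = Q.card := by
  unfold wt ind
  congr 1
  ext s
  simp only [Finset.mem_filter, Finset.mem_univ, true_and]
  by_cases h : s ∈ Q
  · simp [h]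
  · simp [h]

omit [AddCommGroup A] in
/-- Every type is the indicator of its defect set. [folklore] -/
theorem ind_filter (ψ : Ty A) : ind A (univ.filter fun s => ψ s = 1) = ψ := by
  funext s
  simp only [ind, Finset.mem_filter, Finset.mem_univ, true_and]
  have h01 : ∀ u : ZMod 2, u = 0 ∨ u = 1 := by decide
  rcases h01 (ψ s) with h | h
  · rw [h, if_neg (by decide)]
  · rw [h, if_pos rfl]

omit [AddCommGroup A] [DecidableEq A] in
/-- A type of weight `≥ 2` has two distinct defects. [folklore] -/
theorem exists_two_defects {φ : Ty A} (h : 2 ≤ wt A φ) : ∃ i j : A, i ≠ j ∧ φ i = 1 ∧ φ j = 1 := by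
  unfold wt at h
  obtain ⟨i, j, hi, hj, hij⟩ := Finset.one_lt_card_iff.mp h
  simp only [Finset.mem_filter, Finset.mem_univ, true_and] at hi hj
  exact ⟨i, j, hij, hi, hj⟩

omit [AddCommGroup A] in
/-- A type of weight `≤ 1` is `0` or a unit type. [folklore] -/
theorem eq_zero_or_eq_delta_of_wt_le_one {χ : Ty A} (h : wt A χ ≤ 1) : χ = 0 ∨ ∃ s, χ = δ A s := by
  unfold wt at h
  set Q := univ.filter fun s => χ s = 1 with hQ
  have hχ : χ = ind A Q := (ind_filter A χ).symm
  rcases Nat.lt_or_ge Q.card 1 with h0 | h1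
  · left
    have hQe : Q = ∅ := Finset.card_eq_zero.mp (by omega)
    rw [hχ, hQe]
    funext s; simp [ind]
  · right
    have hQ1 : Q.card = 1 := le_antisymm h h1
    obtain ⟨s, hs⟩ := Finset.card_eq_one.mp hQ1
    refine ⟨s, ?_⟩
    rw [hχ, hs]
    funext s'
    simp only [ind, Finset.mem_singleton, delta_apply]

end Lattice

end Summit.HodgeConjecture.CorCM.Census.OddSliceFacesModel
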